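import Literature.NumberTheory.Automorphic.Liu2021.Def411WeilCarriersIrreducibleOfSph
import Literature.NumberTheory.GelbartRogawski1991.FinLocalSplittingsSplitSphericalDarboux
import HarnessLib

/-!
# `hirr` from [Liu2021, Lem. D.1 (1)] AS PRINTED — the survival clause DISCHARGED

Topic `NumberTheory/Automorphic`; namespace `Literature.NumberTheory.Automorphic.Liu2021.Def411WeilCarriers`.  KERNEL
ONLY: theorems, 0 definitions, 0 records, 0 named facts, 0 sorry.

The entry point `Def411WeilCarriers.rho_isIrreducible_of_lemD1AsPrinted` (`Def411IrreducibleOfLemD1AsPrinted`, §5) derives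
the END displays' reading `hirr` — `(rho … hs ι ε χ).IsIrreducible` — from local splittings `𝓢` adapted to the
displayed splitting (`hfac`), [Liu2021, App. D Step 2]'s `μ_v`, the per-place AS-PRINTED cite `hD1 v : LemD1_1AsPrinted …`,
`3 ≤ n`, and the SURVIVAL clause `hS` of Def. 4.11's `⊗'` («the class of `1_{𝒪_vⁿ}` in the local `χ_v`-coinvariants of
`ω_v ∘ (u ↦ u · 1)` is non-zero for almost all `v`»).  The survival clause is now a THEOREM for every restricted family of
local splittings (`GelbartRogawski1991/FinLocalSplittingsSplitSphericalDarboux`: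
`FinLocalSplittings.exists_finset_mk_unitVec_ne_zero` — non-split places by compactness of `E_v¹`
(`Def411WeilCarriersSurvivalNonsplit`), split places by the shift criterion + (SPH) in the eigen-Lagrangian model
(`Def411WeilCarriersSurvivalSplit`, `FinLocalSplittingsSplitSpherical`, `LocalUnitarySplitPlaceDarboux`)).  This file is the
ONE application at the pair datum `(J_V, J_W = (lineOf ε))` of [Liu2021, Def. 4.11]:

* **`survival`** — the `hS` binder of `rho_isIrreducible_of_lemD1AsPrinted` ∕ `…_of_factors`, VERBATIM, as a theorem:
  for the hermitian space `J_V = T_V ⊗ 1` (`det T_V` a unit), the line `(lineOf ε)`, ANY local splittings `𝓢` of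
  `U(J_V ⊗ (lineOf ε))(F_v)` and any `χ ∈ Chi`, off a finite set of places `v` the class of `1_{𝒪_vⁿ}` in the
  `χ_v`-coinvariants of `𝓢.omegaLoc v ∘ (u ↦ u · 1_n)` is non-zero (`n ≠ 0`);
* **`rho_isIrreducible_of_lemD1AsPrinted'`** — §5's theorem WITHOUT the survival binder: `(rho … hs ι ε χ).IsIrreducible`
  from DATA `𝓢` + `hfac`, Step 2's `μ_v` (`hμn`, `hμc`, `hμF`), `3 ≤ n`, and the per-place AS-PRINTED cite
  `hD1 v : LemD1_1AsPrinted (localLemD1Data … χ … v)` ONLY.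

Nothing of [Liu2021] is asserted: Lemma D.1 (1) enters only through the hypothesis `hD1`.  HC_CM is not mentioned here.

## References
* [Liu2021] Y. Liu, Camb. J. Math. 9 (2021) = arXiv:2102.11518, Def. 4.11 (FJcycle.tex l. 2090–2096: `ω(μ,ε,χ) := ⊗'_v
  ω(μ_v,ε_v,χ_v)`, l. 2092 «unramified for all but finitely many v»), App. D §D.1 Steps 1∕2∕3 (l. 5217∕5219∕5221),
  Lem. D.1 (l. 5227; (1) l. 5229; proof l. 5240–5262: split case `E = F × F` l. 5241 (citing [GR90] 2.6), field case l. 5243).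
* [GelbartRogawski1991] S. Gelbart, J. Rogawski, Invent. Math. 105 (1991), §3.1 Prop. 3.1.1 p. 455 L1–3, (3.1.3) p. 456.
-/

set_option autoImplicit false

noncomputable section

open scoped Matrix Kronecker TensorProduct
open NumberField IsDedekindDomain Filter Set
open Literature.NumberTheory Literature.NumberTheory.Automorphic Literature.NumberTheory.Automorphic.UnitaryGroup
open Literature.NumberTheory.GelbartRogawski1991 Literature.NumberTheory.GelbartRogawski1991.UnitaryDualPair
open Literature.NumberTheory.GelbartRogawski1991.UnitaryDualPair.WeilCoinv
open Literature.NumberTheory.Weil1964 Literature.RepresentationTheory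
open Literature.RepresentationTheory.HeisenbergGroup

namespace Literature.NumberTheory.Automorphic.Liu2021.Def411WeilCarriers

variable (F E : Type) [Field F] [NumberField F] [Field E] [NumberField E] [Algebra F E]
variable (c : E ≃ₐ[F] E) (N : ℕ) {n : ℕ} (e : Fin N × Fin 1 ≃ Fin n)
variable (JV : Matrix (Fin N) (Fin N) E) {TV : Matrix (Fin N) (Fin N) F}
variable [Algebra.IsQuadraticExtension F E] {δ : E} (hcδ : c δ = -δ) (hδ : δ ≠ 0) {d : F}
  (hd : δ * δ = algebraMap F E d) (hV : TV.IsSymm) (hVd : IsUnit TV.det) (hJV : JV = TV.map (algebraMap F E))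

section Rho

variable {s : ∀ a : Fˣ, UnitaryGroup.adelicPair F E c N 1 JV (JW F E a) →* adelicMpCont F (Fin n) (adelicGram F e TV (TW F a))}
  (hs : ∀ a : Fˣ, (splittingDatum F E c N 1 e JV (JW F E a) hcδ hδ hd hV (isSymm_TW F a) hVd (isUnit_det_TW F a) hJV
    (JW_eq F E a)).IsCompatible (s a))
variable (ε : Eps F d) (χ : Chi F E c)
variable (𝓢 : LocalSplitting.FinLocalSplittings F E c n hcδ hδ hd (gram F e TV (TW F (lineOf F d ε)))
    (isSymm_gram F e hV (isSymm_TW F (lineOf F d ε)))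
    (reindex_kronecker_eq_gram_map F E e hJV (JW_eq F E (lineOf F d ε))))
variable {G : Type*} [Group G] {ι : G →* UnitaryGroup.finAdelic F E c N JV} (hι : Function.Surjective ι)

include hVd in
/-- **THE SURVIVAL CLAUSE `hS` OF [Liu2021, Def. 4.11]'s `⊗'`, AS A THEOREM.**  For the hermitian space `J_V = T_V ⊗ 1`
(`det T_V` a unit), the line `J_W = (lineOf ε)`, ANY restricted family `𝓢` of local splittings of
`U(J_V ⊗ (lineOf ε))(F_v)` ([GelbartRogawski1991, Prop. 3.1.1 L1–3]) and any automorphic character `χ ∈ Chi`: there is a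
finite set of places `S₁` of `F` off which the class of `1_{𝒪_vⁿ}` in the `χ_v`-coinvariants of `ω_v ∘ (u ↦ u · 1_n)`,
`ω_v = 𝓢.omegaLoc v`, is NON-ZERO (`n ≠ 0`).  One application of
`FinLocalSplittings.exists_finset_mk_unitVec_ne_zero` (non-split places: `E_v¹` compact; split places: the shift
criterion and (SPH) in the eigen-Lagrangian Schrödinger model) at `T := gram (T_V) (T_W)` (a unit: `isUnit_det_gram`) and
the hermitian line `((lineOf ε)).map c)ᵀ = (lineOf ε)` (`JW_map_transpose`).  This is VERBATIM the binder `hS` of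
`rho_isIrreducible_of_lemD1AsPrinted` ∕ `rho_isIrreducible_of_lemD1AsPrinted_of_factors`.
[cite: Liu2021, Def. 4.11 (l. 2090–2096); GelbartRogawski1991, §3.1 Prop. 3.1.1 p. 455 L1–3, (3.1.3) p. 456] -/
theorem survival [NeZero n] :
    ∃ S₁ : Finset (HeightOneSpectrum (𝓞 F)), ∀ v ∉ S₁,
      TwistedCoinv.mk (show Representation ℂ (UnitaryGroup.localPi E c 1 (JW F E (lineOf F d ε)) v) _ from
          (𝓢.omegaLoc v).comp (localCenter E c n (Matrix.reindex e e (JV ⊗ₖ JW F E (lineOf F d ε))) (JW F E (lineOf F d ε))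
            (JW_apply_ne_zero F E _) v))
        (localCharOfCenter F E c (JW F E (lineOf F d ε)) (JW_apply_ne_zero F E _) χ.1 v) (unitVec F (Fin n) v) ≠ 0 :=
  𝓢.exists_finset_mk_unitVec_ne_zero (JW F E (lineOf F d ε)) (JW_apply_ne_zero F E _)
    (isUnit_det_gram F e hVd (isUnit_det_TW F (lineOf F d ε))) (JW_map_transpose F E c (lineOf F d ε)) χ.2.1

include hι in
/-- **`hirr` FROM LEMMA D.1 (1) AS PRINTED, WITH NO SURVIVAL BINDER.**  `Def411WeilCarriers.rho_isIrreducible_of_lemD1AsPrinted`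
(§5 of `Def411IrreducibleOfLemD1AsPrinted`: no unitarity binder) with its survival clause `hS` DISCHARGED by `survival`.
Remaining inputs for `(rho … hs ι ε χ).IsIrreducible`: DATA `𝓢` with `hfac` (the displayed `μ`-splitting, restricted to
the finite-adelic pair, IS the reference section assembled from the local splittings `𝓢`), [Liu2021, App. D Step 2]'s
characters `μ_v` (unitary `hμn`, continuous `hμc`, `μ_v|_{F_vˣ}` with kernel the norms `hμF`), `3 ≤ n`, and the
per-place AS-PRINTED cite `hD1 v : LemD1_1AsPrinted (localLemD1Data … χ … v)` ([Liu2021, Lem. D.1 first sentence + (1)]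
at the local datum, a hypothesis — nothing of [Liu2021] is asserted).
[cite: Liu2021, Def. 4.11 (l. 2090–2096), App. D §D.1 Steps 1∕2∕3 (l. 5217∕5219∕5221), Lemma D.1 (l. 5227; (1) l. 5229); GelbartRogawski1991, §3.1 Prop. 3.1.1 p. 455 L1–3] -/
theorem rho_isIrreducible_of_lemD1AsPrinted'
    (hfac : (pairSmall₁ F E c N 1 e JV (JW F E (lineOf F d ε)) (s (lineOf F d ε))).comp
        (finPairToAdelic F E c N 1 JV (JW F E (lineOf F d ε))) =
      localRefSection F E c N 1 e JV (JW F E (lineOf F d ε)) hcδ hδ hd hV (isSymm_TW F _) hJV (JW_eq F E _) 𝓢)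
    (hn : 3 ≤ n)
    (μ : ∀ v : HeightOneSpectrum (𝓞 F), (LocalRing E v)ˣ →* ℂˣ) (hμn : ∀ v x, ‖((μ v x : ℂˣ) : ℂ)‖ = 1)
    (hμc : ∀ v, Continuous fun x => ((μ v x : ℂˣ) : ℂ))
    (hμF : ∀ (v : HeightOneSpectrum (𝓞 F)) (t : (v.adicCompletion F)ˣ),
      μ v (Units.map (algebraMap (v.adicCompletion F) (LocalRing E v)).toMonoidHom t) = 1 ↔
        ∃ x : (LocalRing E v)ˣ, (x : LocalRing E v) * conjLocal E c v x =
          algebraMap (v.adicCompletion F) (LocalRing E v) t)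
    (hD1 : ∀ v, LemD1_1AsPrinted
      (localLemD1Data F E c N e JV hcδ hδ hd hV hVd hJV (lineOf F d ε) 𝓢 hn μ hμn hμc hμF χ.1
        (norm_chi_eq_one F E c (Algebra.IsQuadraticExtension.finrank_eq_two F E)
          (UnitaryGroup.algEquiv_ne_one_of_apply_eq_neg F E c hcδ hδ) χ) χ.2.1 v)) :
    (rho F E c N e JV hcδ hδ hd hV hVd hJV hs ι ε χ).IsIrreducible :=
  haveI : NeZero n := ⟨by omega⟩
  rho_isIrreducible_of_lemD1AsPrinted F E c N e JV hcδ hδ hd hV hVd hJV hs ε χ 𝓢 hι hfac hn μ hμn hμc hμF hD1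
    (survival F E c N e JV hcδ hδ hd hV hVd hJV ε χ 𝓢)

end Rho

end Literature.NumberTheory.Automorphic.Liu2021.Def411WeilCarriers

end
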